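import Summits.BirchSwinnertonDyer.BirchSwinnertonDyer.Theorems.GenusKolyvaginAtTwoGenusPrimitiveSupplyAtTwoPosDiscShallowKFourPosCellShaStructure
import Summits.BirchSwinnertonDyer.BirchSwinnertonDyer.Theorems.GenusKolyvaginAtTwoGenusDeepSupplyAtTwoNegDiscNarrowKFourCellKolyvaginClass
import HarnessLib

/-!
# Route `GenusKolyvaginAtTwo`, crux 25504 (Δ>0 supply), K₄⁺ cell: KOLYVAGIN'S LEVEL-1 CLASSES `c₁(ℓ)` DESCEND TO `Sel₂(E/ℚ)` —
# UNCONDITIONALLY — and `c₁(ℓ) ≠ 0 ⟺ P(ℓ) ∉ 2E(K[ℓ])` (the Δ>0 twin of the LEAD's `…NegDiscNarrowKFourCellKolyvaginClass` §4, p767174)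

Seat `bsd-line-gk2-p5` g35 (cell `bsd-f1-sign2`, WIDTH-5 attach), `--supports stmt-BirchSwinnertonDyer-25504 --as helper`.  THEOREMS ONLY.
**BSD is NOT proved by this file; nothing about Kolyvagin's conjecture at `2` is asserted; no item is closed; the registered stub C⁺‴ is untouched.**

The LEAD's §§1–3 (p767174) are sign-free: `σ₀ · c₁(ℓ) = c₁(ℓ)` (Gross 5.4 (2)), `c_M(n) ∈ Sel_v` at every finite `v ∤ n` on the habitat `∏ c(E)`
odd (Gross 6.2 (1) incl. bad places), hence `c₁(ℓ) ∈ Sel₂(E_K/K)` once it is Selmer at `λ ∣ ℓ` (`hlam`, the route item Q2 at `2` on the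
`M₀ ≥ 1` cell).  This file supplies the K₄⁺ version of §4, where the descent target is this seat's UNCONDITIONAL invariant-class theorem
`KFourPosCell.existsUnique_mem_selmerGroup_resTorsion_eq_of_kFourPos` (p766630; no Poitou–Tate / Euler–Poincaré print fact: all primes of `d_K` are
silent and the real switch is print-free):

* `existsUnique_mem_selmerGroup_resTorsion_eq_of_kFourPos_of_eq` — p766630 §3 at an exponent merely EQUAL to `2` (Kolyvagin's classes live at `2 ^ 1`).
* **`existsUnique_resTorsion_eq_kolyvaginClass_two_of_kFourPos`** — ON THE K₄⁺ CELL (`W/ℚ` globally minimal, `Δ > 0`, `ρ̄_{E,2}` onto, `∏ c(E)` odd,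
  `#Sel₂(E) = 4 ∧ ∃ c ∈ Sel₂(E), loc_∞ c ≠ 0`; `K` imaginary quadratic, `d_K` odd `≠ −3`, Heegner, `2` split, `σ₀ ≠ 1`; an elliptic model
  `Wd = Cd • E^{(d_K)}` with `ord₂ C(Wd) = 0`): for a Kolyvagin prime `ℓ` at `2`, data `d₁` (conductor `1`), `d` (conductor `ℓ`) with `c₁(ℓ)` Selmer
  at `λ ∣ ℓ`: **a UNIQUE `s ∈ H¹(ℚ, E[2])` has `res_K s = c₁(ℓ)`, it lies in `Sel₂(E/ℚ)`, and `c₁(ℓ) ≠ 0 ⟺ P(ℓ) ∉ 2E(K[ℓ])`.**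
  CONDITIONAL ONLY on `hlam`.
* `not_exists_two_smul_iff_descent_ne_zero_of_kFourPos` — the witness bit in `Sel₂(E/ℚ)`: `P(ℓ) ∉ 2E(K[ℓ]) ⟺` the descended class `s ≠ 0`.
* §2 `existsUnique_resTorsion_eq_kolyvaginClass_two_of_kFourPos_of_family` — the same at a square-free level `n` (twin of LEAD p767500 §5).
* §3 **`exists_compatible_descent_kolyvaginClass_two_of_kFourPos_of_relation`** — MODULO THE ROUTE ITEM Q2 ONLY (`KolyvaginRelationAtTwo`, stmt-24880;
  LEAD p767500 §6 supplies `hlam` with McCallum-compatible data, sign-free): at EVERY Kolyvagin prime `ℓ` the compatible `c₁(ℓ)` descends to a unique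
  `s ∈ Sel₂(E/ℚ)`, and `c₁(ℓ) ≠ 0 ⟺ P(ℓ) ∉ 2E(K[ℓ])`.

READING for K₄⁺ (= the `hK4` binder of `GenusSupplyPos.PrimeFrame.stubC_pos_prime_of_selmerSplit_mixed`, p766811): at a single deep prime the
registered positive-depth kernel asks for `c₁(ℓ)` REALISING one of the three non-zero classes of `Sel₂(E/ℚ)` (`≅ Ш(E/ℚ)[2] ≅ (ℤ/2)²` on the
rank-`0` cell) — exactly as on K₄, and here with no print fact in the descent.  Which primes can do it: transposition-type ones only
(`…SwapTypeReadsDepthBit`, p766882).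

References: [GrossLMS1991] §4 (4.4), §5 Prop. 5.4, §6 Prop. 6.2; [McCallumLMS1991] §4 Prop. 4.4, Cor. 4.5; [Kramer1981] Thm. 1; [MazurRubin2010] Lemma 3.2.
-/

set_option linter.dupNamespace false -- `Summit.<P>.<Sub>` repeats `BirchSwinnertonDyer` (D-0017)
set_option autoImplicit false

noncomputable section

open scoped Classical

namespace Summit.BirchSwinnertonDyer.BirchSwinnertonDyer.Theorems.GenusSupplyNarrow.KFourPosCell

open WeierstrassCurve NumberField IsDedekindDomain Field Function
open Literature.NumberTheory.EllipticCurves Literature.NumberTheory.GaloisRepresentations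
open Literature.NumberTheory.GaloisCohomology
open Literature.NumberTheory.EllipticCurves.ModularForms

variable (W : WeierstrassCurve ℚ) [W.IsElliptic] [W.IsGloballyMinimal] (K : Type) [Field K] [NumberField K]

/-- p766630 `existsUnique_mem_selmerGroup_resTorsion_eq_of_kFourPos` at an exponent `e` merely EQUAL to `2` (bookkeeping: Kolyvagin's classes live
at the syntactic exponent `2 ^ 1`).  UNCONDITIONAL. [cite: Kramer1981, Thm. 1] [cite: GrossLMS1991, §4 (4.4)] -/
theorem existsUnique_mem_selmerGroup_resTorsion_eq_of_kFourPos_of_eq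
    (hpos : 0 < W.Δ) (hs2 : W.HasSurjectiveModNGaloisRep 2) (hTam : Odd W.tamagawaProduct)
    (h4 : Nat.card (W.selmerGroup 2) = 4 ∧ ∃ c ∈ (W.kummerSelmerStructure ((2 : ℕ) : ℤ)).selmerGroup,
      galoisCohomology.localization (W.torsionGaloisModule ((2 : ℕ) : ℤ)) (Sum.inl Rat.infinitePlace) 1 c ≠ 0)
    (hK : IsImaginaryQuadratic K) (hodd : Odd (discr K)) (hH : SatisfiesHeegnerHypothesis (W.conductorNorm ℤ) K)
    (h2K : ((Ideal.span {(2 : ℤ)}).primesOver (𝓞 K)).ncard = 2)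
    {Wd : WeierstrassCurve ℚ} [Wd.IsElliptic] (Cd : VariableChange ℚ) (hCd : Cd • W.quadraticTwist (discr K : ℚ) = Wd)
    (hDEF : padicValNat 2 Wd.tamagawaProduct = 0)
    {σ₀ : K ≃ₐ[ℚ] K} (hσ₀ : σ₀ ≠ 1) {e : ℤ} (he : e = ((2 : ℕ) : ℤ))
    {m : galH1Torsion (W.baseChange K) e} (hm : m ∈ selmerGroup (W.baseChange K) e) (hσm : conjAct W σ₀ e m = m) :
    ∃! s : galH1Torsion W e, resTorsion W K e s = m ∧ s ∈ W.selmerGroup e := by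
  subst he
  exact existsUnique_mem_selmerGroup_resTorsion_eq_of_kFourPos W K hpos hs2 hTam h4 hK hodd hH h2K Cd hCd hDEF hσ₀ hm hσm

/-- **THE LEVEL-1 DEEP CLASSES ON THE K₄⁺ CELL DESCEND TO `Sel₂(E/ℚ)` — UNCONDITIONALLY IN THE DESCENT.**  On the K₄⁺ cell of crux 25504
(`W/ℚ` globally minimal, `Δ > 0`, `ρ̄_{E,2}` onto, `∏ c(E)` odd, `#Sel₂(E) = 4 ∧ ∃ c ∈ Sel₂(E), loc_∞ c ≠ 0`; `K` imaginary quadratic, `d_K` odd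
`≠ −3`, Heegner for `N_E`, `2` split, `σ₀ ≠ 1`; `Wd = Cd • E^{(d_K)}` elliptic with `ord₂ C(Wd) = 0`), for a Kolyvagin prime `ℓ` at `2` and data
`d₁` (conductor `1`), `d` (conductor `ℓ`) whose class `c₁(ℓ)` satisfies the Selmer condition at the place(s) above `ℓ` (`hlam` — Q2 at `2` on the
`M₀ ≥ 1` cell): **there is a unique `s ∈ H¹(ℚ, E[2])` with `res_K s = c₁(ℓ)`, it lies in `Sel₂(E/ℚ)`, and `c₁(ℓ) ≠ 0 ⟺ P(ℓ) ∉ 2E(K[ℓ])`.**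
(LEAD p767174 §3 `kolyvaginClass_two_mem_selmerGroup_of_dvd` + §1 `conjAct_kolyvaginClass_two_eq_self` + p766630 + McCallum Cor. 4.5 at `2`
`GenusKoly.kolyvaginClass_two_ne_zero_iff_not_two_dvd_prime`.)  `E(K)[2] = 0` is derived (`forall_two_smul_eq_zero_baseChange_of_kFourPos`).
CONDITIONAL only on `hlam`.  BSD is NOT proved by this. [cite: GrossLMS1991, §4 (4.4), §5 Prop. 5.4 (2), §6 Prop. 6.2] [cite: McCallumLMS1991, Prop. 4.4, Cor. 4.5] [cite: Kramer1981, Thm. 1] -/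
theorem existsUnique_resTorsion_eq_kolyvaginClass_two_of_kFourPos [NeZero (W.conductorNorm ℤ)]
    (hpos : 0 < W.Δ) (hs2 : W.HasSurjectiveModNGaloisRep 2) (hTam : Odd W.tamagawaProduct)
    (h4 : Nat.card (W.selmerGroup 2) = 4 ∧ ∃ c ∈ (W.kummerSelmerStructure ((2 : ℕ) : ℤ)).selmerGroup,
      galoisCohomology.localization (W.torsionGaloisModule ((2 : ℕ) : ℤ)) (Sum.inl Rat.infinitePlace) 1 c ≠ 0)
    (hK : IsImaginaryQuadratic K) (hodd : Odd (discr K)) (h3 : discr K ≠ -3) (hH : SatisfiesHeegnerHypothesis (W.conductorNorm ℤ) K)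
    (h2K : ((Ideal.span {(2 : ℤ)}).primesOver (𝓞 K)).ncard = 2)
    {Wd : WeierstrassCurve ℚ} [Wd.IsElliptic] (Cd : VariableChange ℚ) (hCd : Cd • W.quadraticTwist (discr K : ℚ) = Wd)
    (hDEF : padicValNat 2 Wd.tamagawaProduct = 0)
    {σ₀ : K ≃ₐ[ℚ] K} (hσ₀ : σ₀ ≠ 1)
    {Dt : ModularParametrizationData W (W.conductorNorm ℤ)} {β : ℤ} {ι : K →+* ℂ}
    {ℓ : ℕ} (hKoly : Zhang2014.IsKolyvaginPrime (W.conductorNorm ℤ) W K 2 ℓ)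
    (d₁ : KolyvaginHeegnerData Dt β ι 1) (d : KolyvaginHeegnerData Dt β ι ℓ)
    (hlam : ∀ v : HeightOneSpectrum (𝓞 K), ((ℓ : ℕ) : 𝓞 K) ∈ v.asIdeal →
      d.kolyvaginClass Nat.prime_two 1 ∈ selmerLocalKer (W.baseChange K) (v.adicCompletion K) ((2 ^ 1 : ℕ) : ℤ)) :
    (∃! s : galH1Torsion W ((2 ^ 1 : ℕ) : ℤ),
        resTorsion W K ((2 ^ 1 : ℕ) : ℤ) s = d.kolyvaginClass Nat.prime_two 1 ∧ s ∈ W.selmerGroup ((2 ^ 1 : ℕ) : ℤ)) ∧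
      (d.kolyvaginClass Nat.prime_two 1 ≠ 0 ↔
        ¬ ∃ Q : (W.baseChange (ringClassField K ι ℓ)).toAffine.Point, (2 : ℤ) • Q = d.derivedPoint) := by
  have hsurj : W.HasSurjectiveModNGaloisRep ((2 : ℤ) ^ 1) := by rw [pow_one]; exact hs2
  have hSelK : d.kolyvaginClass Nat.prime_two 1 ∈ selmerGroup (W.baseChange K) ((2 ^ 1 : ℕ) : ℤ) :=
    KFourCell.kolyvaginClass_two_mem_selmerGroup_of_dvd hK hH hTam hKoly.1.ne_zero d 1 hlam
  have hfix := KFourCell.conjAct_kolyvaginClass_two_eq_self hK hodd h3 hH hsurj hKoly d₁ d hσ₀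
  exact ⟨existsUnique_mem_selmerGroup_resTorsion_eq_of_kFourPos_of_eq W K hpos hs2 hTam h4 hK hodd hH h2K Cd hCd hDEF hσ₀
      (by norm_num) hSelK hfix,
    GenusKoly.kolyvaginClass_two_ne_zero_iff_not_two_dvd_prime hK hodd h3 hH hsurj hKoly d₁ d⟩

/-- **THE WITNESS BIT IN `Sel₂(E/ℚ)`.**  On the K₄⁺ cell, with `s ∈ Sel₂(E/ℚ)` the descended class of `c₁(ℓ)` (`res_K s = c₁(ℓ)`):
**`P(ℓ) ∉ 2E(K[ℓ]) ⟺ s ≠ 0`** — Kolyvagin's first deep derivative at `2` is a K₄⁺-witness at the single prime `ℓ` iff it REALISES a non-zero class of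
`Sel₂(E/ℚ) ≅ Ш(E/ℚ)[2]`.  CONDITIONAL only on `hlam`. [cite: GrossLMS1991, §4 (4.4), §11] [cite: McCallumLMS1991, Cor. 4.5] [cite: Kramer1981, Thm. 1] -/
theorem not_exists_two_smul_iff_descent_ne_zero_of_kFourPos [NeZero (W.conductorNorm ℤ)]
    (hpos : 0 < W.Δ) (hs2 : W.HasSurjectiveModNGaloisRep 2) (hTam : Odd W.tamagawaProduct)
    (h4 : Nat.card (W.selmerGroup 2) = 4 ∧ ∃ c ∈ (W.kummerSelmerStructure ((2 : ℕ) : ℤ)).selmerGroup,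
      galoisCohomology.localization (W.torsionGaloisModule ((2 : ℕ) : ℤ)) (Sum.inl Rat.infinitePlace) 1 c ≠ 0)
    (hK : IsImaginaryQuadratic K) (hodd : Odd (discr K)) (h3 : discr K ≠ -3) (hH : SatisfiesHeegnerHypothesis (W.conductorNorm ℤ) K)
    (h2K : ((Ideal.span {(2 : ℤ)}).primesOver (𝓞 K)).ncard = 2)
    {Wd : WeierstrassCurve ℚ} [Wd.IsElliptic] (Cd : VariableChange ℚ) (hCd : Cd • W.quadraticTwist (discr K : ℚ) = Wd)
    (hDEF : padicValNat 2 Wd.tamagawaProduct = 0)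
    {σ₀ : K ≃ₐ[ℚ] K} (hσ₀ : σ₀ ≠ 1)
    {Dt : ModularParametrizationData W (W.conductorNorm ℤ)} {β : ℤ} {ι : K →+* ℂ}
    {ℓ : ℕ} (hKoly : Zhang2014.IsKolyvaginPrime (W.conductorNorm ℤ) W K 2 ℓ)
    (d₁ : KolyvaginHeegnerData Dt β ι 1) (d : KolyvaginHeegnerData Dt β ι ℓ)
    (hlam : ∀ v : HeightOneSpectrum (𝓞 K), ((ℓ : ℕ) : 𝓞 K) ∈ v.asIdeal →
      d.kolyvaginClass Nat.prime_two 1 ∈ selmerLocalKer (W.baseChange K) (v.adicCompletion K) ((2 ^ 1 : ℕ) : ℤ))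
    {s : galH1Torsion W ((2 ^ 1 : ℕ) : ℤ)} (hs : resTorsion W K ((2 ^ 1 : ℕ) : ℤ) s = d.kolyvaginClass Nat.prime_two 1) :
    (¬ ∃ Q : (W.baseChange (ringClassField K ι ℓ)).toAffine.Point, (2 : ℤ) • Q = d.derivedPoint) ↔ s ≠ 0 := by
  obtain ⟨-, hiff⟩ := existsUnique_resTorsion_eq_kolyvaginClass_two_of_kFourPos W K hpos hs2 hTam h4 hK hodd h3 hH h2K Cd hCd hDEF hσ₀
    hKoly d₁ d hlam
  rw [← hiff, ← hs]
  have h2 : Module.finrank ℚ K = 2 := hK.1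
  have hL := forall_two_smul_eq_zero_baseChange_of_kFourPos W K hs2 h2
  have hL' : ∀ P : (W.baseChange K).toAffine.Point, ((2 ^ 1 : ℕ) : ℤ) • P = 0 → P = 0 := by
    intro P hP; exact hL P (by simpa using hP)
  obtain ⟨θ, hθ, hc⟩ := Literature.NumberTheory.EllipticCurves.exists_sq_eq_discr_not_mem_range K h2
  have hinj := GenusExact.EigenClassesFinite.resTorsion_injective_of_noTorsion W K h2 hθ hc ((2 ^ 1 : ℕ) : ℤ) hL'
  refine ⟨fun h h0 ↦ h (by rw [h0, map_zero]), fun h h0 ↦ h (hinj (by rw [h0, map_zero]))⟩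

/-! ## §2 The same at a square-free level `n` (the K₄⁺ witness shape `∃ n d, Squarefree n ∧ …`) -/

/-- **At a square-free level `n` with data at every divisor** (Δ>0 twin of LEAD p767500 `…_of_cell_of_family`): on the K₄⁺ cell, the top class `c₁(n)`
of a family of data at the divisors of a square-free product `n` of Kolyvagin primes at `2`, Selmer at the places dividing `n`, is `res_K s` for a
unique `s`, `s ∈ Sel₂(E/ℚ)`, and `c₁(n) ≠ 0 ⟺ P(n) ∉ 2E(K[n])`.  CONDITIONAL only on `hlam` (no Poitou–Tate / Euler–Poincaré on Δ>0).
[cite: GrossLMS1991, §4 (4.4), Prop. 4.7 (1), §5 Prop. 5.4 (2)] [cite: McCallumLMS1991, Prop. 4.4, Cor. 4.5] [cite: Kramer1981, Thm. 1] -/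
theorem existsUnique_resTorsion_eq_kolyvaginClass_two_of_kFourPos_of_family [NeZero (W.conductorNorm ℤ)]
    (hpos : 0 < W.Δ) (hs2 : W.HasSurjectiveModNGaloisRep 2) (hTam : Odd W.tamagawaProduct)
    (h4 : Nat.card (W.selmerGroup 2) = 4 ∧ ∃ c ∈ (W.kummerSelmerStructure ((2 : ℕ) : ℤ)).selmerGroup,
      galoisCohomology.localization (W.torsionGaloisModule ((2 : ℕ) : ℤ)) (Sum.inl Rat.infinitePlace) 1 c ≠ 0)
    (hK : IsImaginaryQuadratic K) (hodd : Odd (discr K)) (h3 : discr K ≠ -3) (hH : SatisfiesHeegnerHypothesis (W.conductorNorm ℤ) K)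
    (h2K : ((Ideal.span {(2 : ℤ)}).primesOver (𝓞 K)).ncard = 2)
    {Wd : WeierstrassCurve ℚ} [Wd.IsElliptic] (Cd : VariableChange ℚ) (hCd : Cd • W.quadraticTwist (discr K : ℚ) = Wd)
    (hDEF : padicValNat 2 Wd.tamagawaProduct = 0)
    {σ₀ : K ≃ₐ[ℚ] K} (hσ₀ : σ₀ ≠ 1)
    {Dt : ModularParametrizationData W (W.conductorNorm ℤ)} {β : ℤ} {ι : K →+* ℂ}
    {n : ℕ} (hn : Squarefree n) (hkol : ∀ q ∈ n.primeFactors, Zhang2014.IsKolyvaginPrime (W.conductorNorm ℤ) W K 2 q)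
    (fam : (m : ℕ) → m ∣ n → KolyvaginHeegnerData Dt β ι m)
    (hlam : ∀ v : HeightOneSpectrum (𝓞 K), ((n : ℕ) : 𝓞 K) ∈ v.asIdeal →
      (fam n dvd_rfl).kolyvaginClass Nat.prime_two 1 ∈ selmerLocalKer (W.baseChange K) (v.adicCompletion K) ((2 ^ 1 : ℕ) : ℤ)) :
    (∃! s : galH1Torsion W ((2 ^ 1 : ℕ) : ℤ),
        resTorsion W K ((2 ^ 1 : ℕ) : ℤ) s = (fam n dvd_rfl).kolyvaginClass Nat.prime_two 1 ∧ s ∈ W.selmerGroup ((2 ^ 1 : ℕ) : ℤ)) ∧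
      ((fam n dvd_rfl).kolyvaginClass Nat.prime_two 1 ≠ 0 ↔
        ¬ ∃ Q : (W.baseChange (ringClassField K ι n)).toAffine.Point, (2 : ℤ) • Q = (fam n dvd_rfl).derivedPoint) := by
  have hsurj : W.HasSurjectiveModNGaloisRep ((2 : ℤ) ^ 1) := by rw [pow_one]; exact hs2
  have hSelK : (fam n dvd_rfl).kolyvaginClass Nat.prime_two 1 ∈ selmerGroup (W.baseChange K) ((2 ^ 1 : ℕ) : ℤ) :=
    KFourCell.kolyvaginClass_two_mem_selmerGroup_of_dvd hK hH hTam hn.ne_zero (fam n dvd_rfl) 1 hlam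
  have hfix := KFourCell.conjAct_kolyvaginClass_two_eq_self_of_family hK hodd h3 hH hsurj hn hkol fam hσ₀
  refine ⟨existsUnique_mem_selmerGroup_resTorsion_eq_of_kFourPos_of_eq W K hpos hs2 hTam h4 hK hodd hH h2K Cd hCd hDEF hσ₀
      (by norm_num) hSelK hfix, ?_⟩
  rw [GenusKoly.kolyvaginClass_two_ne_zero_iff_not_two_dvd hK hodd h3 hH hsurj hn hkol fam]

/-! ## §3 Modulo the route item Q2 only: at EVERY Kolyvagin prime a compatible `c₁(ℓ)` descends to `Sel₂(E/ℚ)` -/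

section Relation

open Summit.BirchSwinnertonDyer.BirchSwinnertonDyer.Theses.GenusKolyvaginAtTwo (KolyvaginRelationAtTwo)

/-- **K₄⁺ IN `Sel₂(E/ℚ)`-CURRENCY, MODULO Q2.**  On the K₄⁺ cell (habitat: non-CM, `ρ̄_{E,2^m}` onto for all `m`, `∏ c(E)` odd, `Δ > 0`, the K₄⁺
clause; `K` imaginary quadratic, `d_K` odd `≠ −3`, Heegner, `2` split, `σ₀ ≠ 1`; `Wd = Cd • E^{(d_K)}` with `ord₂ C(Wd) = 0`; a conductor-`1` datum `d₁`
on the `M₀ ≥ 1` cell), GIVEN the route item Q2 `KolyvaginRelationAtTwo` (stmt-24880): for EVERY Kolyvagin prime `ℓ` at `2` there is a datum `d` of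
conductor `1·ℓ` compatible with `d₁` (LEAD p767500 §6, sign-free) whose class `c₁(ℓ)` is `res_K s` for a UNIQUE `s ∈ H¹(ℚ, E[2])`, with
`s ∈ Sel₂(E/ℚ)`, and `c₁(ℓ) ≠ 0 ⟺ P(ℓ) ∉ 2E(K[ℓ])`.  So, modulo Q2, the K₄⁺ witness at a single transposition-deep prime is EXACTLY «some
`c₁(ℓ)` descends to a NON-ZERO class of `Sel₂(E/ℚ)`».  CONDITIONAL on Q2 only.  BSD is NOT proved by this.
[cite: McCallumLMS1991, §4 Prop. 4.4, Cor. 4.5] [cite: GrossLMS1991, §3 Prop. 3.7, §6 Prop. 6.2 (2)] [cite: Kramer1981, Thm. 1] -/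
theorem exists_compatible_descent_kolyvaginClass_two_of_kFourPos_of_relation [NeZero (W.conductorNorm ℤ)]
    (hQ2 : KolyvaginRelationAtTwo) (hcm : ¬ W.HasCM) (hρ : ∀ m : ℕ, W.HasSurjectiveModNGaloisRep (2 ^ m : ℕ))
    (hpos : 0 < W.Δ) (hTam : Odd W.tamagawaProduct)
    (h4 : Nat.card (W.selmerGroup 2) = 4 ∧ ∃ c ∈ (W.kummerSelmerStructure ((2 : ℕ) : ℤ)).selmerGroup,
      galoisCohomology.localization (W.torsionGaloisModule ((2 : ℕ) : ℤ)) (Sum.inl Rat.infinitePlace) 1 c ≠ 0)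
    (hK : IsImaginaryQuadratic K) (hodd : Odd (discr K)) (h3 : discr K ≠ -3) (hH : SatisfiesHeegnerHypothesis (W.conductorNorm ℤ) K)
    (h2K : ((Ideal.span {(2 : ℤ)}).primesOver (𝓞 K)).ncard = 2)
    {Wd : WeierstrassCurve ℚ} [Wd.IsElliptic] (Cd : VariableChange ℚ) (hCd : Cd • W.quadraticTwist (discr K : ℚ) = Wd)
    (hDEF : padicValNat 2 Wd.tamagawaProduct = 0)
    {σ₀ : K ≃ₐ[ℚ] K} (hσ₀ : σ₀ ≠ 1)
    (Dt : ModularParametrizationData W (W.conductorNorm ℤ)) (β : ℤ) (ι : K →+* ℂ) (d₁ : KolyvaginHeegnerData Dt β ι 1)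
    {M₀ : ℕ} (hM : 1 ≤ M₀)
    (hdiv : ∃ Q : (W.baseChange (ringClassField K ι 1)).toAffine.Point, ((2 ^ M₀ : ℕ) : ℤ) • Q = d₁.derivedPoint)
    {ℓ : ℕ} (hKoly : Zhang2014.IsKolyvaginPrime (W.conductorNorm ℤ) W K 2 ℓ) :
    ∃ d : KolyvaginHeegnerData Dt β ι (1 * ℓ),
      (∀ (x : ringClassField K ι 1) (x' : ringClassField K ι (1 * ℓ)), (x : ℂ) = x' → d.emb x' = d₁.emb x) ∧
      (∃! s : galH1Torsion W ((2 ^ 1 : ℕ) : ℤ),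
        resTorsion W K ((2 ^ 1 : ℕ) : ℤ) s = d.kolyvaginClass Nat.prime_two 1 ∧ s ∈ W.selmerGroup ((2 ^ 1 : ℕ) : ℤ)) ∧
      (d.kolyvaginClass Nat.prime_two 1 ≠ 0 ↔
        ¬ ∃ Q : (W.baseChange (ringClassField K ι (1 * ℓ))).toAffine.Point, (2 : ℤ) • Q = d.derivedPoint) := by
  have hs2 : W.HasSurjectiveModNGaloisRep 2 := by exact_mod_cast hρ 1
  obtain ⟨d, -, -, hemb, hlam⟩ := KFourCell.exists_compatible_kolyvaginClass_two_mem_selmerLocalKer_of_relation hQ2 hcm hρ hK hodd h3 hH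
    Dt β ι d₁ hM hdiv hKoly
  have hKoly' : Zhang2014.IsKolyvaginPrime (W.conductorNorm ℤ) W K 2 (1 * ℓ) := by rw [one_mul]; exact hKoly
  have hlam' : ∀ v : HeightOneSpectrum (𝓞 K), (((1 * ℓ : ℕ) : ℕ) : 𝓞 K) ∈ v.asIdeal →
      d.kolyvaginClass Nat.prime_two 1 ∈ selmerLocalKer (W.baseChange K) (v.adicCompletion K) ((2 ^ 1 : ℕ) : ℤ) := by
    intro v hv
    exact hlam v (by simpa using hv)
  exact ⟨d, hemb, existsUnique_resTorsion_eq_kolyvaginClass_two_of_kFourPos W K hpos hs2 hTam h4 hK hodd h3 hH h2K Cd hCd hDEF hσ₀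
    hKoly' d₁ d hlam'⟩

end Relation

end Summit.BirchSwinnertonDyer.BirchSwinnertonDyer.Theorems.GenusSupplyNarrow.KFourPosCell

end
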